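import Summits.SmoothPoincare4.SmoothPoincare4.Theorems.SullivanDualWitnessChargeHelperMemberGraphMain
import Summits.SmoothPoincare4.SmoothPoincare4.Theorems.SullivanDualWitnessChargeHelperMemberGraphFunction
import Summits.SmoothPoincare4.SmoothPoincare4.Theorems.SullivanDualTameOrBrodyR4StubExteriorSchwarz
import Mathlib.Analysis.Complex.Basic

/-!
# Helper `helper_memberTailDecay` of line `Sketch` for crux `WitnessCharge`
(item stmt-SmoothPoincare4-7824; route `SullivanDual`, crux
`Summit.SmoothPoincare4.SmoothPoincare4.Theses.SullivanDual.WitnessCharge`; line `Sketch`,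
registered stub `helper_memberTailDecay` of the lead's cycle-2 helper skeleton, wave 2 —
(N)-branch uniform control: uniform decay of the tail of a pencil member)

**Uniform tail decay of a pencil member.** Let `J` be STANDARD on the punctured `ε'`-chart-ball
`B_{ε'}` at `p` (closed `ε'`-ball inside the chart target) and let `u : ℂ → Σ∖p` be a pencil member
of intercept `b` (`IsPencilMember J u b`). Write `z = (Ycoord p (u ξ)).1`, `w = (Ycoord p (u ξ)).2`
for the complex flat coordinates along `u`. Then for every `R > ε'⁻¹` and every parameter `ξ` with
`u ξ ∈ B_{ε'}` and `‖z‖ ≥ 2R`,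

  `‖w − b‖ ≤ 4 · max ε'⁻¹ ‖b‖ · R / ‖z‖`.

Proof — bookkeeping over landed facts. By `helper_memberGraph` ((P3)(a), the far part of the
member over `{R < ‖z‖}` is single-sheeted) and `helper_memberGraphFunction` (its graph function),
there is `h : ℂ → ℂ` holomorphic on `{R < ‖z‖}`, with `h z = w` along the member there,
`‖h‖ ≤ W := max ε'⁻¹ ‖b‖`, and `h → b` at infinity. The function `g = h − b` is holomorphic on
`{R < ‖z‖}`, bounded by `2W` (`‖b‖ ≤ W`), tends to `0` at infinity, and is bounded by `2W` on the
circle `‖z‖ = 2R`; the Schwarz lemma at infinity `stub_exteriorSchwarz` (crux `TameOrBrodyR4`,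
line `Sketch`) with `R₁ = R`, `R₂ = 2R`, `L = 2W` gives `‖g z‖ ≤ 2W · 2R / ‖z‖` for `‖z‖ ≥ 2R`,
which at the graph point `z = (Ycoord p (u ξ)).1` (`h z = w`) is the claim.
-/

noncomputable section

-- the registered namespace `Summit.SmoothPoincare4.SmoothPoincare4.…` repeats a component
set_option linter.dupNamespace false

open scoped Manifold ContDiff Topology
open Set Filter Literature.Geometry.Kaehler Literature.Geometry.Symplectic
  Literature.Topology.FourManifolds
open Summit.SmoothPoincare4.SmoothPoincare4.Cruxes.TameOrBrodyR4.Sketch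

namespace Summit.SmoothPoincare4.SmoothPoincare4.Theorems.WitnessCharge.PencilIncompleteness

/-- **Uniform tail decay of a pencil member ((N)-branch uniform control).** For `J` standard on the
punctured `ε'`-chart-ball at `p` (closed `ε'`-ball inside the chart target), a pencil member `u` of
intercept `b`, `R > ε'⁻¹`, and a parameter `ξ` with `u ξ ∈ B_{ε'}` and
`2R ≤ ‖(Ycoord p (u ξ)).1‖`:
`‖(Ycoord p (u ξ)).2 − b‖ ≤ 4 · max ε'⁻¹ ‖b‖ · R / ‖(Ycoord p (u ξ)).1‖`. The graph function `h`
of the member over `{R < ‖z‖}` (`helper_memberGraph`, `helper_memberGraphFunction`) minus `b` is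
holomorphic, bounded by `2 max ε'⁻¹ ‖b‖`, and tends to `0` at infinity, so the Schwarz lemma at
infinity (`stub_exteriorSchwarz`, radii `R < 2R`) bounds it by `2 max ε'⁻¹ ‖b‖ · 2R / ‖z‖` on
`{2R ≤ ‖z‖}`; transport to the member through the graph identity `h z = w`. -/
theorem helper_memberTailDecay :
    ∀ (S : HomotopySphere 4) (p : S.carrier)
      (J : ∀ x : punctured p, TangentSpace (𝓡 4) x →L[ℝ] TangentSpace (𝓡 4) x) (ε' : ℝ)
      (u : ℂ → punctured p) (b : ℂ),
      0 < ε' →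
      Metric.closedBall (extChartAt (𝓡 4) p p) ε' ⊆ (extChartAt (𝓡 4) p).target →
      (∀ x : punctured p, InPuncturedChartBall p ε' x →
        ∀ (v : TangentSpace (𝓡 4) x) (b : EuclideanSpace ℝ (Fin 4)),
          inner ℝ (fderiv ℝ inversion (extChartAt (𝓡 4) p x.1 - extChartAt (𝓡 4) p p)
            (mfderiv (𝓡 4) 𝓘(ℝ, EuclideanSpace ℝ (Fin 4))
              (fun z : punctured p => extChartAt (𝓡 4) p z.1) x (J x v))) b
          = stdSymplecticForm (fderiv ℝ inversion (extChartAt (𝓡 4) p x.1 - extChartAt (𝓡 4) p p)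
            (mfderiv (𝓡 4) 𝓘(ℝ, EuclideanSpace ℝ (Fin 4))
              (fun z : punctured p => extChartAt (𝓡 4) p z.1) x v)) b) →
      IsPencilMember J u b →
      ∀ R : ℝ, ε'⁻¹ < R → ∀ ξ : ℂ, InPuncturedChartBall p ε' (u ξ) →
        2 * R ≤ ‖(Ycoord p (u ξ)).1‖ →
        ‖(Ycoord p (u ξ)).2 - b‖ ≤ 4 * max ε'⁻¹ ‖b‖ * R / ‖(Ycoord p (u ξ)).1‖ := by
  intro S p J ε' u b hε' hball hJstd hmem R hR ξ hξball hξR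
  have hR0 : 0 < R := (inv_pos.2 hε').trans hR
  -- the graph function `h` of the member over `{R < ‖z‖}`
  obtain ⟨hbij, hder⟩ := helper_memberGraph S p J ε' u b hε' hball hJstd hmem R hR
  obtain ⟨h, hhdiff, hgraph, hbound, hlim, -⟩ :=
    helper_memberGraphFunction S p J ε' u b hε' hball hJstd hmem R hR hbij hder
  have hbW : ‖b‖ ≤ max ε'⁻¹ ‖b‖ := le_max_right _ _
  -- `g = h - b`: holomorphic on `{R < ‖z‖}`, bounded by `2W`, tending to `0` at infinity
  have hgdiff : DifferentiableOn ℂ (fun z : ℂ => h z - b) {c : ℂ | R < ‖c‖} :=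
    hhdiff.sub_const b
  have hgbound : ∀ c : ℂ, R < ‖c‖ → ‖h c - b‖ ≤ 2 * max ε'⁻¹ ‖b‖ := fun c hc =>
    calc ‖h c - b‖ ≤ ‖h c‖ + ‖b‖ := norm_sub_le _ _
      _ ≤ max ε'⁻¹ ‖b‖ + max ε'⁻¹ ‖b‖ := add_le_add (hbound c hc) hbW
      _ = 2 * max ε'⁻¹ ‖b‖ := by ring
  have hgb : ∃ M : ℝ, ∀ c : ℂ, R < ‖c‖ → ‖h c - b‖ ≤ M := ⟨_, hgbound⟩
  have hg0 : Tendsto (fun z : ℂ => h z - b) (cocompact ℂ) (𝓝 0) :=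
    tendsto_sub_nhds_zero_iff.2 hlim
  have hgL : ∀ c : ℂ, ‖c‖ = 2 * R → ‖h c - b‖ ≤ 2 * max ε'⁻¹ ‖b‖ := fun c hc =>
    hgbound c (by rw [hc]; linarith)
  -- the Schwarz lemma at infinity with radii `R < 2R` and circle bound `2W`
  have key := stub_exteriorSchwarz (fun z : ℂ => h z - b) R (2 * R) (2 * max ε'⁻¹ ‖b‖) hR0
    (by linarith) hgdiff hgb hg0 hgL
  -- transport to the member through the graph identity at `z = (Ycoord p (u ξ)).1`
  have hzR : R < ‖(Ycoord p (u ξ)).1‖ := lt_of_lt_of_le (by linarith) hξR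
  have hdecay : ‖h (Ycoord p (u ξ)).1 - b‖ ≤
      2 * max ε'⁻¹ ‖b‖ * (2 * R) / ‖(Ycoord p (u ξ)).1‖ := key _ hξR
  rw [hgraph ξ hξball hzR] at hdecay
  calc ‖(Ycoord p (u ξ)).2 - b‖ ≤ 2 * max ε'⁻¹ ‖b‖ * (2 * R) / ‖(Ycoord p (u ξ)).1‖ := hdecay
    _ = 4 * max ε'⁻¹ ‖b‖ * R / ‖(Ycoord p (u ξ)).1‖ := by ring

end Summit.SmoothPoincare4.SmoothPoincare4.Theorems.WitnessCharge.PencilIncompleteness
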